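import Summits.Ventures.YMGap.RobustBall.RowsSU3StarPVW
import Summits.Ventures.YMGap.RobustBall.StarRowsSU3PV2
import HarnessLib

/-!
# Venture YMGap, track ROBUST-BALL (Y2) — `SU(3)` HYPOTHESIS-FREE TIER-2 (diameter-weighted ball) star cells on the centred Schwinger–Dyson
# variance (PV2): schemas (`d = 4` torus, `d = 3` Y4 weighted currency) and the `d = 4` cells

HONEST FRAMING. WHAT THIS IS: a venture file (cell `pub-ymgap`, track Y2 ROBUST-BALL, seat engine-2 (g10); 0 compute): ds-2's weighted robust star
door in VARIANCE FORM (`RobustStarDoorVariance.torusClusteringOnBallW_upTo_of_robustStar_variance`, `clusterDomainClusteringW_dim3_of_robustStar_variance`)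
fed with the PV2 inputs `StarRowsSU3PV2.su3_pv2_star_inputs` (Bakry–Émery Poincaré × engine-2 g10's CENTRED Schwinger–Dyson variance
`OneLinkVarianceSDCentred`, envelope `16τ(τ−1) + 9τ³R² ≤ 16(τ−1)K_s²(1/2−R)`): schemas `su3_torusClusteringOnBallW_pv2Star` (`d = 4`),
`su3_clusterDomainClusteringW_dim3_pv2Star` (`d = 3`), and `SU(3)` cells on the one-parameter weighted ball `ClusterDomain κ (2ε) ε`, class K outright:
`d = 4` (`TorusClusteringOnBallW 3 4 β κ (2ε) ε (24e^{2t}) t` for every `0 ≤ β ≤ β_W/3`), rate `t = 1/100` for EVERY `κ ≥ 1/100` (`_t100`):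
(1/8, .266) (1/5, .183) (1/4, .124) (3/10, .063) (31/100, .050); the lineage weight and rate `κ = t = log 6/5` (`_w65`): (1/8, .206) (1/4, .083) (27/100, .062) (3/10, .030) (31/100, .019).
BEFORE (hypothesis-free `SU(3)` tier 2, `d = 4`): ds-2 W17 `RowsSU3StarPVW` t100 (1/8, .259) (1/5, .167) (1/4, .100), w65 (1/4, .062); engine-2 g9
`StarRowsSU3PVW` (Kantorovich form, κ ≥ log 6/5) (1/8, .112) … (27/100, .017).  Tier-2 frontier (w65) `27/100 → 31/100`.  The `d = 3` cells are the
sibling `StarRowsSU3PV2WDim3.lean`.  WHAT THIS IS NOT: nothing beyond the Bakry–Émery window; radii/rates are door artefacts; nothing about the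
continuum.  Certificates: `HOME/pub-ymgap-engine-2/pv2/cert_w.{py,json}` (exact `Fraction` arithmetic; `e^{1/100}`, `e^{1/50}` by the tree's
`exp_le_1_100_w`, `exp_le_1_50_w`; `e^{log 6/5} = 6/5`).
-/

noncomputable section

open Finset
open Literature.MathematicalPhysics.QuantumLattice (fundamentalRep)
open Literature.MathematicalPhysics.QuantumFieldTheory hiding ZdEdge
open Literature.MathematicalPhysics.QuantumFieldTheory.Balaban1983to89.StrongCouplingTorusWindow
open Summit.Ventures.YMGap.StarResolventDim (Delta gaugeR doorPoly Delta_pos_of_door gaugeR_lt_one_of_door)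

namespace Summit.Ventures.YMGap.RobustBall

/-! ### 1. Schemas, `SU(3)`, tier 2 (weighted ball), PV2 variance form -/

/-- **SCHEMA, `SU(3)`, `d = 4`, TIER 2, HYPOTHESIS-FREE (PV2 variance form)**: `TorusClusteringOnBallW 3 4 β κ ε₀ ε₁ (24 e^{2t}) t` for every
`0 ≤ β ≤ β_W/3` (`0 ≤ t ≤ κ`, `T₁ ≥ e^{t}`, `T₂ ≥ e^{2t}`, radius `R = 6β_W/9 < 1/2`). [folklore] -/
theorem su3_torusClusteringOnBallW_pv2Star (Kn : ℕ) {βW κ ε₀ ε₁ c lam E E₂ τ Ks Sq t T₁ T₂ : ℝ} (hβ0 : 0 < βW)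
    (hR : βW / 9 * 6 < 1 / 2) (hε₁ : 0 ≤ ε₁) (ht : 0 ≤ t) (htκ : t ≤ κ) (hE : Real.exp ε₀ ≤ E) (hE₂ : Real.exp (ε₀ / 2) ≤ E₂)
    (hτ : 1 < τ) (hKs0 : 0 ≤ Ks)
    (hKs : 16 * τ * (τ - 1) + 9 * τ ^ 3 * (βW / 9 * 6) ^ 2 ≤ 16 * (τ - 1) * (Ks ^ 2 * (1 / 2 - βW / 9 * 6)))
    (hSq0 : 0 ≤ Sq) (hSq : 1 ≤ 3 * Sq ^ 2 * (1 / 2 - βW / 9 * 6)) (hT₁ : Real.exp t ≤ T₁) (hT₂ : Real.exp (2 * t) ≤ T₂)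
    (hc : E * Ks * (βW / 9) ≤ c) (hlam : E₂ * Sq * ε₁ ≤ lam) (hθ1 : 6 * c + lam < 1) (hcd : doorPoly 4 c < 1)
    (hρ1 : T₁ * (gaugeR 4 c + (T₂ * lam + (6 * c + lam) ^ Kn * (16 * (T₂ * lam))) / (1 - (6 * c + lam))) < 1) :
    ∀ β : ℝ, 0 ≤ β → β ≤ βW / 3 → TorusClusteringOnBallW 3 4 β κ ε₀ ε₁ (24 * Real.exp (2 * t)) t := by
  set R : ℝ := βW / 9 * 6 with hRdef
  have hgap : 0 < 1 / 2 - R := by linarith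
  obtain ⟨hP, hV, h1, h2⟩ := su3_pv2_star_inputs (x := βW / 9) hR hτ hε₁ (by positivity) hE hE₂ hKs0 hKs hSq0 hSq
  have hc0 : 0 ≤ c := le_trans (le_trans (by positivity) h1) hc
  have hE20 : 0 ≤ E₂ := (Real.exp_pos _).le.trans hE₂
  have hlam0 : 0 ≤ lam := le_trans (by positivity) hlam
  set θ : ℝ := 6 * c + lam with hθ
  set ρ : ℝ := Real.exp t * (gaugeR 4 c +
    (Real.exp (2 * t) * lam + θ ^ Kn * (16 * (Real.exp (2 * t) * lam))) / (1 - θ)) with hρ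
  have hθ0 : 0 ≤ θ := by positivity
  have h1θ : 0 < 1 - θ := by linarith
  have hgR := gaugeR_lt_one_of_door (d := 4) (by norm_num) hc0 hcd
  have hθK : 0 ≤ θ ^ Kn := pow_nonneg hθ0 Kn
  have hin0 : 0 ≤ gaugeR 4 c + (Real.exp (2 * t) * lam + θ ^ Kn * (16 * (Real.exp (2 * t) * lam))) / (1 - θ) :=
    add_nonneg hgR.1 (div_nonneg (by positivity) h1θ.le)
  have hin : gaugeR 4 c + (Real.exp (2 * t) * lam + θ ^ Kn * (16 * (Real.exp (2 * t) * lam))) / (1 - θ) ≤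
      gaugeR 4 c + (T₂ * lam + θ ^ Kn * (16 * (T₂ * lam))) / (1 - θ) := by
    have h1' : Real.exp (2 * t) * lam ≤ T₂ * lam := mul_le_mul_of_nonneg_right hT₂ hlam0
    have h2' : θ ^ Kn * (16 * (Real.exp (2 * t) * lam)) ≤ θ ^ Kn * (16 * (T₂ * lam)) :=
      mul_le_mul_of_nonneg_left (by linarith) hθK
    exact add_le_add le_rfl (div_le_div_of_nonneg_right (add_le_add h1' h2') h1θ.le)
  have hρ1' : ρ < 1 :=
    calc ρ ≤ T₁ * (gaugeR 4 c + (T₂ * lam + θ ^ Kn * (16 * (T₂ * lam))) / (1 - θ)) :=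
          mul_le_mul hT₁ hin hin0 ((Real.exp_pos _).le.trans hT₁)
      _ < 1 := hρ1
  have e33 : βW / 3 / ((3 : ℕ) : ℝ) = βW / 9 := by norm_num; ring
  have hb' : βW / 3 / ((3 : ℕ) : ℝ) * (2 * (((4 : ℕ) : ℝ) - 1)) ≤ R := by rw [e33, hRdef]; norm_num
  have hc' : Real.exp ε₀ * Real.sqrt (1 / (3 * (1 / 2 - R)) * (3 * (1 / 2 - R) * Ks ^ 2)) * (βW / 3 / ((3 : ℕ) : ℝ)) ≤ c := by
    rw [e33]; exact h1.trans hc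
  have hθ' : θ = (2 * ((4 : ℕ) : ℝ) - 2) * c + lam := by rw [hθ]; push_cast; ring
  have hρ' : ρ = Real.exp t * (gaugeR 4 c +
      (Real.exp (2 * t) * lam + θ ^ Kn * (4 * ((4 : ℕ) : ℝ) * (Real.exp (2 * t) * lam))) / (1 - θ)) := by
    rw [hρ]; push_cast; ring
  have h := torusClusteringOnBallW_upTo_of_robustStar_variance (d := 4) (N := 3) (by norm_num) (by norm_num) Kn (by positivity)
    (by positivity) hb' hP hV hε₁ ht htκ hc' (h2.trans hlam) hθ' hθ1 hcd hρ' hρ1'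
  have e3 : (8 : ℝ) * ((3 : ℕ) : ℝ) = 24 := by norm_num
  rw [two_mul_sq_two_sqrt_nat, e3] at h
  exact h

/-- **SCHEMA, `SU(3)`, `d = 3`, TIER 2, HYPOTHESIS-FREE (PV2 variance form)**: Y4's `ClusterDomainClustering` on `ClusterDomain κ ε₀ ε₁` up to tree
coupling `β_W/3` at rate `t`, plus the torus form (radius `R = 4β_W/9`; door `doorPoly 3 c < 1`, `θ = 4c + λ`). [folklore] -/
theorem su3_clusterDomainClusteringW_dim3_pv2Star (Kn : ℕ) {βW κ ε₀ ε₁ c lam E E₂ τ Ks Sq t T₁ T₂ : ℝ} (hβ0 : 0 < βW)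
    (hR : βW / 9 * 4 < 1 / 2) (hε₁ : 0 ≤ ε₁) (ht : 0 ≤ t) (htκ : t ≤ κ) (hE : Real.exp ε₀ ≤ E) (hE₂ : Real.exp (ε₀ / 2) ≤ E₂)
    (hτ : 1 < τ) (hKs0 : 0 ≤ Ks)
    (hKs : 16 * τ * (τ - 1) + 9 * τ ^ 3 * (βW / 9 * 4) ^ 2 ≤ 16 * (τ - 1) * (Ks ^ 2 * (1 / 2 - βW / 9 * 4)))
    (hSq0 : 0 ≤ Sq) (hSq : 1 ≤ 3 * Sq ^ 2 * (1 / 2 - βW / 9 * 4)) (hT₁ : Real.exp t ≤ T₁) (hT₂ : Real.exp (2 * t) ≤ T₂)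
    (hc : E * Ks * (βW / 9) ≤ c) (hlam : E₂ * Sq * ε₁ ≤ lam) (hθ1 : 4 * c + lam < 1) (hcd : doorPoly 3 c < 1)
    (hρ1 : T₁ * (gaugeR 3 c + (T₂ * lam + (4 * c + lam) ^ Kn * (12 * (T₂ * lam))) / (1 - (4 * c + lam))) < 1) :
    YM3IR.ClusterDomainClustering (G := SUN 3)
        ⟨fundamentalRep (Fin 3), βW / 3, fun _ _ W => W ∈ ClusterDomain κ ε₀ ε₁⟩ suFrobDist t ∧
      ∀ β : ℝ, 0 ≤ β → β ≤ βW / 3 → TorusClusteringOnBallW 3 3 β κ ε₀ ε₁ (24 * Real.exp (2 * t)) t := by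
  set R : ℝ := βW / 9 * 4 with hRdef
  have hgap : 0 < 1 / 2 - R := by linarith
  obtain ⟨hP, hV, h1, h2⟩ := su3_pv2_star_inputs (x := βW / 9) hR hτ hε₁ (by positivity) hE hE₂ hKs0 hKs hSq0 hSq
  have hc0 : 0 ≤ c := le_trans (le_trans (by positivity) h1) hc
  have hE20 : 0 ≤ E₂ := (Real.exp_pos _).le.trans hE₂
  have hlam0 : 0 ≤ lam := le_trans (by positivity) hlam
  set θ : ℝ := 4 * c + lam with hθ
  set ρ : ℝ := Real.exp t * (gaugeR 3 c +
    (Real.exp (2 * t) * lam + θ ^ Kn * (12 * (Real.exp (2 * t) * lam))) / (1 - θ)) with hρ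
  have hθ0 : 0 ≤ θ := by positivity
  have h1θ : 0 < 1 - θ := by linarith
  have hgR := gaugeR_lt_one_of_door (d := 3) (by norm_num) hc0 hcd
  have hθK : 0 ≤ θ ^ Kn := pow_nonneg hθ0 Kn
  have hin0 : 0 ≤ gaugeR 3 c + (Real.exp (2 * t) * lam + θ ^ Kn * (12 * (Real.exp (2 * t) * lam))) / (1 - θ) :=
    add_nonneg hgR.1 (div_nonneg (by positivity) h1θ.le)
  have hin : gaugeR 3 c + (Real.exp (2 * t) * lam + θ ^ Kn * (12 * (Real.exp (2 * t) * lam))) / (1 - θ) ≤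
      gaugeR 3 c + (T₂ * lam + θ ^ Kn * (12 * (T₂ * lam))) / (1 - θ) := by
    have h1' : Real.exp (2 * t) * lam ≤ T₂ * lam := mul_le_mul_of_nonneg_right hT₂ hlam0
    have h2' : θ ^ Kn * (12 * (Real.exp (2 * t) * lam)) ≤ θ ^ Kn * (12 * (T₂ * lam)) :=
      mul_le_mul_of_nonneg_left (by linarith) hθK
    exact add_le_add le_rfl (div_le_div_of_nonneg_right (add_le_add h1' h2') h1θ.le)
  have hρ1' : ρ < 1 :=
    calc ρ ≤ T₁ * (gaugeR 3 c + (T₂ * lam + θ ^ Kn * (12 * (T₂ * lam))) / (1 - θ)) :=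
          mul_le_mul hT₁ hin hin0 ((Real.exp_pos _).le.trans hT₁)
      _ < 1 := hρ1
  have e33 : βW / 3 / ((3 : ℕ) : ℝ) = βW / 9 := by norm_num; ring
  have hb4 : βW / 3 / ((3 : ℕ) : ℝ) * 4 ≤ R := by rw [e33, hRdef]
  have hb' : βW / 3 / ((3 : ℕ) : ℝ) * (2 * (((3 : ℕ) : ℝ) - 1)) ≤ R := by rw [e33, hRdef]; norm_num
  have hc' : Real.exp ε₀ * Real.sqrt (1 / (3 * (1 / 2 - R)) * (3 * (1 / 2 - R) * Ks ^ 2)) * (βW / 3 / ((3 : ℕ) : ℝ)) ≤ c := by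
    rw [e33]; exact h1.trans hc
  have hθ' : θ = (2 * ((3 : ℕ) : ℝ) - 2) * c + lam := by rw [hθ]; push_cast; ring
  have hρ' : ρ = Real.exp t * (gaugeR 3 c +
      (Real.exp (2 * t) * lam + θ ^ Kn * (4 * ((3 : ℕ) : ℝ) * (Real.exp (2 * t) * lam))) / (1 - θ)) := by
    rw [hρ]; push_cast; ring
  refine ⟨clusterDomainClusteringW_dim3_of_robustStar_variance (N := 3) (by norm_num) Kn (by positivity) (by positivity) hb4 hP hV hε₁ ht
    htκ hc' (h2.trans hlam) hθ hθ1 hcd hρ hρ1', ?_⟩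
  have h := torusClusteringOnBallW_upTo_of_robustStar_variance (d := 3) (N := 3) (by norm_num) (by norm_num) Kn (by positivity)
    (by positivity) hb' hP hV hε₁ ht htκ hc' (h2.trans hlam) hθ' hθ1 hcd hρ' hρ1'
  have e3 : (8 : ℝ) * ((3 : ℕ) : ℝ) = 24 := by norm_num
  rw [two_mul_sq_two_sqrt_nat, e3] at h
  exact h

/-! ### 2. The `d = 4` tier-2 cells -/

/-- **TIER-2 ROW `(β_W, ε) = (1/8, .266)`, `SU(3)`, `d = 4`, HYPOTHESIS-FREE, PV2 variance form**, rate `1/100`, EVERY weight `κ ≥ 1/100`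
(`τ = 531 / 500`, `K_s = 6609 / 4000`, `S_q = 223607 / 250000`, `c = 19533 / 500000`, `λ = 310421 / 1000000`, `ρ ≈ 0.9976`). [folklore] -/
theorem su3_torusClusteringOnBallW_pv2Star_oneEighth_t100 :
    ∀ κ : ℝ, 1 / 100 ≤ κ → ∀ β : ℝ, 0 ≤ β → β ≤ 1 / 24 →
      TorusClusteringOnBallW 3 4 β κ (133 / 250) (133 / 500) (24 * Real.exp (1 / 50)) (1 / 100) := by
  intro κ hκ
  have h := su3_torusClusteringOnBallW_pv2Star 20 (βW := 1 / 8) (κ := κ) (ε₀ := 133 / 250) (ε₁ := 133 / 500) (c := 19533 / 500000) (lam := 310421 / 1000000) (E := 1702371 / 1000000) (E₂ := 1304737 / 1000000) (τ := 531 / 500) (Ks := 6609 / 4000) (Sq := 223607 / 250000) (t := 1 / 100) (T₁ := 1010051 / 1000000) (T₂ := 510101 / 500000)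
    (by norm_num) (by norm_num) (by norm_num) (by norm_num) hκ (by refine (Real.exp_bound' (x := 133 / 250) (by norm_num) (by norm_num) (n := 5) (by norm_num)).trans ?_; simp only [Finset.sum_range_succ, Finset.sum_range_zero, Nat.factorial]; norm_num)
    (by refine (Real.exp_bound' (x := 133 / 250 / 2) (by norm_num) (by norm_num) (n := 5) (by norm_num)).trans ?_; simp only [Finset.sum_range_succ, Finset.sum_range_zero, Nat.factorial]; norm_num)
    (by norm_num) (by norm_num) (by norm_num) (by norm_num) (by norm_num) exp_le_1_100_w (by rw [show (2 : ℝ) * (1 / 100) = 1 / 50 by norm_num]; exact exp_le_1_50_w)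
    (by norm_num) (by norm_num) (by norm_num) (by unfold doorPoly; norm_num) (by unfold gaugeR Delta; norm_num)
  have e1 : (1 / 8 : ℝ) / 3 = 1 / 24 := by norm_num
  have e2 : (2 : ℝ) * (1 / 100) = 1 / 50 := by norm_num
  rw [e1, e2] at h
  exact h

/-- **TIER-2 ROW `(β_W, ε) = (1/5, .183)`, `SU(3)`, `d = 4`, HYPOTHESIS-FREE, PV2 variance form**, rate `1/100`, EVERY weight `κ ≥ 1/100`
(`τ = 549 / 500`, `K_s = 22923 / 12500`, `S_q = 953463 / 1000000`, `c = 58763 / 1000000`, `λ = 209523 / 1000000`, `ρ ≈ 0.9998`). [folklore] -/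
theorem su3_torusClusteringOnBallW_pv2Star_oneFifth_t100 :
    ∀ κ : ℝ, 1 / 100 ≤ κ → ∀ β : ℝ, 0 ≤ β → β ≤ 1 / 15 →
      TorusClusteringOnBallW 3 4 β κ (183 / 500) (183 / 1000) (24 * Real.exp (1 / 50)) (1 / 100) := by
  intro κ hκ
  have h := su3_torusClusteringOnBallW_pv2Star 20 (βW := 1 / 5) (κ := κ) (ε₀ := 183 / 500) (ε₁ := 183 / 1000) (c := 58763 / 1000000) (lam := 209523 / 1000000) (E := 1441963 / 1000000) (E₂ := 240163 / 200000) (τ := 549 / 500) (Ks := 22923 / 12500) (Sq := 953463 / 1000000) (t := 1 / 100) (T₁ := 1010051 / 1000000) (T₂ := 510101 / 500000)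
    (by norm_num) (by norm_num) (by norm_num) (by norm_num) hκ (by refine (Real.exp_bound' (x := 183 / 500) (by norm_num) (by norm_num) (n := 5) (by norm_num)).trans ?_; simp only [Finset.sum_range_succ, Finset.sum_range_zero, Nat.factorial]; norm_num)
    (by refine (Real.exp_bound' (x := 183 / 500 / 2) (by norm_num) (by norm_num) (n := 5) (by norm_num)).trans ?_; simp only [Finset.sum_range_succ, Finset.sum_range_zero, Nat.factorial]; norm_num)
    (by norm_num) (by norm_num) (by norm_num) (by norm_num) (by norm_num) exp_le_1_100_w (by rw [show (2 : ℝ) * (1 / 100) = 1 / 50 by norm_num]; exact exp_le_1_50_w)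
    (by norm_num) (by norm_num) (by norm_num) (by unfold doorPoly; norm_num) (by unfold gaugeR Delta; norm_num)
  have e1 : (1 / 5 : ℝ) / 3 = 1 / 15 := by norm_num
  have e2 : (2 : ℝ) * (1 / 100) = 1 / 50 := by norm_num
  rw [e1, e2] at h
  exact h

/-- **TIER-2 ROW `(β_W, ε) = (1/4, .124)`, `SU(3)`, `d = 4`, HYPOTHESIS-FREE, PV2 variance form**, rate `1/100`, EVERY weight `κ ≥ 1/100`
(`τ = 561 / 500`, `K_s = 39541 / 20000`, `S_q = 1`, `c = 8797 / 125000`, `λ = 14037 / 100000`, `ρ ≈ 0.9936`). [folklore] -/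
theorem su3_torusClusteringOnBallW_pv2Star_oneQuarter_t100 :
    ∀ κ : ℝ, 1 / 100 ≤ κ → ∀ β : ℝ, 0 ≤ β → β ≤ 1 / 12 →
      TorusClusteringOnBallW 3 4 β κ (31 / 125) (31 / 250) (24 * Real.exp (1 / 50)) (1 / 100) := by
  intro κ hκ
  have h := su3_torusClusteringOnBallW_pv2Star 20 (βW := 1 / 4) (κ := κ) (ε₀ := 31 / 125) (ε₁ := 31 / 250) (c := 8797 / 125000) (lam := 14037 / 100000) (E := 640731 / 500000) (E₂ := 70751 / 62500) (τ := 561 / 500) (Ks := 39541 / 20000) (Sq := 1) (t := 1 / 100) (T₁ := 1010051 / 1000000) (T₂ := 510101 / 500000)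
    (by norm_num) (by norm_num) (by norm_num) (by norm_num) hκ (by refine (Real.exp_bound' (x := 31 / 125) (by norm_num) (by norm_num) (n := 5) (by norm_num)).trans ?_; simp only [Finset.sum_range_succ, Finset.sum_range_zero, Nat.factorial]; norm_num)
    (by refine (Real.exp_bound' (x := 31 / 125 / 2) (by norm_num) (by norm_num) (n := 5) (by norm_num)).trans ?_; simp only [Finset.sum_range_succ, Finset.sum_range_zero, Nat.factorial]; norm_num)
    (by norm_num) (by norm_num) (by norm_num) (by norm_num) (by norm_num) exp_le_1_100_w (by rw [show (2 : ℝ) * (1 / 100) = 1 / 50 by norm_num]; exact exp_le_1_50_w)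
    (by norm_num) (by norm_num) (by norm_num) (by unfold doorPoly; norm_num) (by unfold gaugeR Delta; norm_num)
  have e1 : (1 / 4 : ℝ) / 3 = 1 / 12 := by norm_num
  have e2 : (2 : ℝ) * (1 / 100) = 1 / 50 := by norm_num
  rw [e1, e2] at h
  exact h

/-- **TIER-2 ROW `(β_W, ε) = (3/10, .063)`, `SU(3)`, `d = 4`, HYPOTHESIS-FREE, PV2 variance form**, rate `1/100`, EVERY weight `κ ≥ 1/100`
(`τ = 143 / 125`, `K_s = 53579 / 25000`, `S_q = 1054093 / 1000000`, `c = 10129 / 125000`, `λ = 70727 / 1000000`, `ρ ≈ 0.9986`). [folklore] -/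
theorem su3_torusClusteringOnBallW_pv2Star_threeTenths_t100 :
    ∀ κ : ℝ, 1 / 100 ≤ κ → ∀ β : ℝ, 0 ≤ β → β ≤ 1 / 10 →
      TorusClusteringOnBallW 3 4 β κ (63 / 500) (63 / 1000) (24 * Real.exp (1 / 50)) (1 / 100) := by
  intro κ hκ
  have h := su3_torusClusteringOnBallW_pv2Star 20 (βW := 3 / 10) (κ := κ) (ε₀ := 63 / 500) (ε₁ := 63 / 1000) (c := 10129 / 125000) (lam := 70727 / 1000000) (E := 1134283 / 1000000) (E₂ := 1065027 / 1000000) (τ := 143 / 125) (Ks := 53579 / 25000) (Sq := 1054093 / 1000000) (t := 1 / 100) (T₁ := 1010051 / 1000000) (T₂ := 510101 / 500000)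
    (by norm_num) (by norm_num) (by norm_num) (by norm_num) hκ (by refine (Real.exp_bound' (x := 63 / 500) (by norm_num) (by norm_num) (n := 5) (by norm_num)).trans ?_; simp only [Finset.sum_range_succ, Finset.sum_range_zero, Nat.factorial]; norm_num)
    (by refine (Real.exp_bound' (x := 63 / 500 / 2) (by norm_num) (by norm_num) (n := 5) (by norm_num)).trans ?_; simp only [Finset.sum_range_succ, Finset.sum_range_zero, Nat.factorial]; norm_num)
    (by norm_num) (by norm_num) (by norm_num) (by norm_num) (by norm_num) exp_le_1_100_w (by rw [show (2 : ℝ) * (1 / 100) = 1 / 50 by norm_num]; exact exp_le_1_50_w)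
    (by norm_num) (by norm_num) (by norm_num) (by unfold doorPoly; norm_num) (by unfold gaugeR Delta; norm_num)
  have e1 : (3 / 10 : ℝ) / 3 = 1 / 10 := by norm_num
  have e2 : (2 : ℝ) * (1 / 100) = 1 / 50 := by norm_num
  rw [e1, e2] at h
  exact h

/-- **TIER-2 ROW `(β_W, ε) = (31/100, .050)`, `SU(3)`, `d = 4`, HYPOTHESIS-FREE, PV2 variance form**, rate `1/100`, EVERY weight `κ ≥ 1/100`
(`τ = 287 / 250`, `K_s = 108983 / 50000`, `S_q = 266501 / 250000`, `c = 41487 / 500000`, `λ = 28017 / 500000`, `ρ ≈ 0.9983`). [folklore] -/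
theorem su3_torusClusteringOnBallW_pv2Star_thirtyOneHundredths_t100 :
    ∀ κ : ℝ, 1 / 100 ≤ κ → ∀ β : ℝ, 0 ≤ β → β ≤ 31 / 300 →
      TorusClusteringOnBallW 3 4 β κ (1 / 10) (1 / 20) (24 * Real.exp (1 / 50)) (1 / 100) := by
  intro κ hκ
  have h := su3_torusClusteringOnBallW_pv2Star 20 (βW := 31 / 100) (κ := κ) (ε₀ := 1 / 10) (ε₁ := 1 / 20) (c := 41487 / 500000) (lam := 28017 / 500000) (E := 1105171 / 1000000) (E₂ := 131409 / 125000) (τ := 287 / 250) (Ks := 108983 / 50000) (Sq := 266501 / 250000) (t := 1 / 100) (T₁ := 1010051 / 1000000) (T₂ := 510101 / 500000)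
    (by norm_num) (by norm_num) (by norm_num) (by norm_num) hκ (by refine (Real.exp_bound' (x := 1 / 10) (by norm_num) (by norm_num) (n := 5) (by norm_num)).trans ?_; simp only [Finset.sum_range_succ, Finset.sum_range_zero, Nat.factorial]; norm_num)
    (by refine (Real.exp_bound' (x := 1 / 10 / 2) (by norm_num) (by norm_num) (n := 5) (by norm_num)).trans ?_; simp only [Finset.sum_range_succ, Finset.sum_range_zero, Nat.factorial]; norm_num)
    (by norm_num) (by norm_num) (by norm_num) (by norm_num) (by norm_num) exp_le_1_100_w (by rw [show (2 : ℝ) * (1 / 100) = 1 / 50 by norm_num]; exact exp_le_1_50_w)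
    (by norm_num) (by norm_num) (by norm_num) (by unfold doorPoly; norm_num) (by unfold gaugeR Delta; norm_num)
  have e1 : (31 / 100 : ℝ) / 3 = 31 / 300 := by norm_num
  have e2 : (2 : ℝ) * (1 / 100) = 1 / 50 := by norm_num
  rw [e1, e2] at h
  exact h

/-- **TIER-2 ROW `(β_W, ε) = (1/8, .206)`, `SU(3)`, `d = 4`, HYPOTHESIS-FREE, PV2 variance form**, the lineage weight and rate `κ = t = log 6/5`
(`τ = 531 / 500`, `K_s = 6609 / 4000`, `S_q = 223607 / 250000`, `c = 4331 / 125000`, `λ = 226401 / 1000000`, `ρ ≈ 0.9937`). [folklore] -/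
theorem su3_torusClusteringOnBallW_pv2Star_oneEighth_w65 :
    ∀ β : ℝ, 0 ≤ β → β ≤ 1 / 24 →
      TorusClusteringOnBallW 3 4 β (Real.log (6 / 5)) (103 / 250) (103 / 500) (24 * Real.exp (2 * Real.log (6 / 5))) (Real.log (6 / 5)) := by
  have h := su3_torusClusteringOnBallW_pv2Star 20 (βW := 1 / 8) (κ := Real.log (6 / 5)) (ε₀ := 103 / 250) (ε₁ := 103 / 500) (c := 4331 / 125000) (lam := 226401 / 1000000) (E := 188731 / 125000) (E₂ := 614377 / 500000) (τ := 531 / 500) (Ks := 6609 / 4000) (Sq := 223607 / 250000) (t := Real.log (6 / 5)) (T₁ := 6 / 5) (T₂ := 36 / 25)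
    (by norm_num) (by norm_num) (by norm_num) (Real.log_nonneg (by norm_num)) le_rfl (by refine (Real.exp_bound' (x := 103 / 250) (by norm_num) (by norm_num) (n := 5) (by norm_num)).trans ?_; simp only [Finset.sum_range_succ, Finset.sum_range_zero, Nat.factorial]; norm_num)
    (by refine (Real.exp_bound' (x := 103 / 250 / 2) (by norm_num) (by norm_num) (n := 5) (by norm_num)).trans ?_; simp only [Finset.sum_range_succ, Finset.sum_range_zero, Nat.factorial]; norm_num)
    (by norm_num) (by norm_num) (by norm_num) (by norm_num) (by norm_num) (by rw [Real.exp_log (by norm_num)]) (by rw [show (2 : ℝ) * Real.log (6 / 5) = Real.log ((6 / 5) ^ 2) by rw [Real.log_pow]; norm_num, Real.exp_log (by norm_num)]; norm_num)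
    (by norm_num) (by norm_num) (by norm_num) (by unfold doorPoly; norm_num) (by unfold gaugeR Delta; norm_num)
  have e1 : (1 / 8 : ℝ) / 3 = 1 / 24 := by norm_num
  rw [e1] at h
  exact h

/-- **TIER-2 ROW `(β_W, ε) = (1/4, .083)`, `SU(3)`, `d = 4`, HYPOTHESIS-FREE, PV2 variance form**, the lineage weight and rate `κ = t = log 6/5`
(`τ = 561 / 500`, `K_s = 39541 / 20000`, `S_q = 1`, `c = 12967 / 200000`, `λ = 90183 / 1000000`, `ρ ≈ 0.9940`). [folklore] -/
theorem su3_torusClusteringOnBallW_pv2Star_oneQuarter_w65 :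
    ∀ β : ℝ, 0 ≤ β → β ≤ 1 / 12 →
      TorusClusteringOnBallW 3 4 β (Real.log (6 / 5)) (83 / 500) (83 / 1000) (24 * Real.exp (2 * Real.log (6 / 5))) (Real.log (6 / 5)) := by
  have h := su3_torusClusteringOnBallW_pv2Star 20 (βW := 1 / 4) (κ := Real.log (6 / 5)) (ε₀ := 83 / 500) (ε₁ := 83 / 1000) (c := 12967 / 200000) (lam := 90183 / 1000000) (E := 590287 / 500000) (E₂ := 543271 / 500000) (τ := 561 / 500) (Ks := 39541 / 20000) (Sq := 1) (t := Real.log (6 / 5)) (T₁ := 6 / 5) (T₂ := 36 / 25)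
    (by norm_num) (by norm_num) (by norm_num) (Real.log_nonneg (by norm_num)) le_rfl (by refine (Real.exp_bound' (x := 83 / 500) (by norm_num) (by norm_num) (n := 5) (by norm_num)).trans ?_; simp only [Finset.sum_range_succ, Finset.sum_range_zero, Nat.factorial]; norm_num)
    (by refine (Real.exp_bound' (x := 83 / 500 / 2) (by norm_num) (by norm_num) (n := 5) (by norm_num)).trans ?_; simp only [Finset.sum_range_succ, Finset.sum_range_zero, Nat.factorial]; norm_num)
    (by norm_num) (by norm_num) (by norm_num) (by norm_num) (by norm_num) (by rw [Real.exp_log (by norm_num)]) (by rw [show (2 : ℝ) * Real.log (6 / 5) = Real.log ((6 / 5) ^ 2) by rw [Real.log_pow]; norm_num, Real.exp_log (by norm_num)]; norm_num)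
    (by norm_num) (by norm_num) (by norm_num) (by unfold doorPoly; norm_num) (by unfold gaugeR Delta; norm_num)
  have e1 : (1 / 4 : ℝ) / 3 = 1 / 12 := by norm_num
  rw [e1] at h
  exact h

/-- **TIER-2 ROW `(β_W, ε) = (27/100, .062)`, `SU(3)`, `d = 4`, HYPOTHESIS-FREE, PV2 variance form**, the lineage weight and rate `κ = t = log 6/5`
(`τ = 113 / 100`, `K_s = 51011 / 25000`, `S_q = 1020621 / 1000000`, `c = 13859 / 200000`, `λ = 33663 / 500000`, `ρ ≈ 0.9938`). [folklore] -/
theorem su3_torusClusteringOnBallW_pv2Star_twentySevenHundredths_w65 :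
    ∀ β : ℝ, 0 ≤ β → β ≤ 9 / 100 →
      TorusClusteringOnBallW 3 4 β (Real.log (6 / 5)) (31 / 250) (31 / 500) (24 * Real.exp (2 * Real.log (6 / 5))) (Real.log (6 / 5)) := by
  have h := su3_torusClusteringOnBallW_pv2Star 20 (βW := 27 / 100) (κ := Real.log (6 / 5)) (ε₀ := 31 / 250) (ε₁ := 31 / 500) (c := 13859 / 200000) (lam := 33663 / 500000) (E := 70751 / 62500) (E₂ := 1063963 / 1000000) (τ := 113 / 100) (Ks := 51011 / 25000) (Sq := 1020621 / 1000000) (t := Real.log (6 / 5)) (T₁ := 6 / 5) (T₂ := 36 / 25)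
    (by norm_num) (by norm_num) (by norm_num) (Real.log_nonneg (by norm_num)) le_rfl (by refine (Real.exp_bound' (x := 31 / 250) (by norm_num) (by norm_num) (n := 5) (by norm_num)).trans ?_; simp only [Finset.sum_range_succ, Finset.sum_range_zero, Nat.factorial]; norm_num)
    (by refine (Real.exp_bound' (x := 31 / 250 / 2) (by norm_num) (by norm_num) (n := 5) (by norm_num)).trans ?_; simp only [Finset.sum_range_succ, Finset.sum_range_zero, Nat.factorial]; norm_num)
    (by norm_num) (by norm_num) (by norm_num) (by norm_num) (by norm_num) (by rw [Real.exp_log (by norm_num)]) (by rw [show (2 : ℝ) * Real.log (6 / 5) = Real.log ((6 / 5) ^ 2) by rw [Real.log_pow]; norm_num, Real.exp_log (by norm_num)]; norm_num)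
    (by norm_num) (by norm_num) (by norm_num) (by unfold doorPoly; norm_num) (by unfold gaugeR Delta; norm_num)
  have e1 : (27 / 100 : ℝ) / 3 = 9 / 100 := by norm_num
  rw [e1] at h
  exact h

/-- **TIER-2 ROW `(β_W, ε) = (3/10, .030)`, `SU(3)`, `d = 4`, HYPOTHESIS-FREE, PV2 variance form**, the lineage weight and rate `κ = t = log 6/5`
(`τ = 143 / 125`, `K_s = 53579 / 25000`, `S_q = 1054093 / 1000000`, `c = 75857 / 1000000`, `λ = 16293 / 500000`, `ρ ≈ 0.9975`). [folklore] -/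
theorem su3_torusClusteringOnBallW_pv2Star_threeTenths_w65 :
    ∀ β : ℝ, 0 ≤ β → β ≤ 1 / 10 →
      TorusClusteringOnBallW 3 4 β (Real.log (6 / 5)) (3 / 50) (3 / 100) (24 * Real.exp (2 * Real.log (6 / 5))) (Real.log (6 / 5)) := by
  have h := su3_torusClusteringOnBallW_pv2Star 20 (βW := 3 / 10) (κ := Real.log (6 / 5)) (ε₀ := 3 / 50) (ε₁ := 3 / 100) (c := 75857 / 1000000) (lam := 16293 / 500000) (E := 1061837 / 1000000) (E₂ := 206091 / 200000) (τ := 143 / 125) (Ks := 53579 / 25000) (Sq := 1054093 / 1000000) (t := Real.log (6 / 5)) (T₁ := 6 / 5) (T₂ := 36 / 25)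
    (by norm_num) (by norm_num) (by norm_num) (Real.log_nonneg (by norm_num)) le_rfl (by refine (Real.exp_bound' (x := 3 / 50) (by norm_num) (by norm_num) (n := 5) (by norm_num)).trans ?_; simp only [Finset.sum_range_succ, Finset.sum_range_zero, Nat.factorial]; norm_num)
    (by refine (Real.exp_bound' (x := 3 / 50 / 2) (by norm_num) (by norm_num) (n := 5) (by norm_num)).trans ?_; simp only [Finset.sum_range_succ, Finset.sum_range_zero, Nat.factorial]; norm_num)
    (by norm_num) (by norm_num) (by norm_num) (by norm_num) (by norm_num) (by rw [Real.exp_log (by norm_num)]) (by rw [show (2 : ℝ) * Real.log (6 / 5) = Real.log ((6 / 5) ^ 2) by rw [Real.log_pow]; norm_num, Real.exp_log (by norm_num)]; norm_num)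
    (by norm_num) (by norm_num) (by norm_num) (by unfold doorPoly; norm_num) (by unfold gaugeR Delta; norm_num)
  have e1 : (3 / 10 : ℝ) / 3 = 1 / 10 := by norm_num
  rw [e1] at h
  exact h

/-- **TIER-2 ROW `(β_W, ε) = (31/100, .019)`, `SU(3)`, `d = 4`, HYPOTHESIS-FREE, PV2 variance form**, the lineage weight and rate `κ = t = log 6/5`
(`τ = 287 / 250`, `K_s = 108983 / 50000`, `S_q = 266501 / 250000`, `c = 38993 / 500000`, `λ = 20643 / 1000000`, `ρ ≈ 0.9987`). [folklore] -/
theorem su3_torusClusteringOnBallW_pv2Star_thirtyOneHundredths_w65 :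
    ∀ β : ℝ, 0 ≤ β → β ≤ 31 / 300 →
      TorusClusteringOnBallW 3 4 β (Real.log (6 / 5)) (19 / 500) (19 / 1000) (24 * Real.exp (2 * Real.log (6 / 5))) (Real.log (6 / 5)) := by
  have h := su3_torusClusteringOnBallW_pv2Star 20 (βW := 31 / 100) (κ := Real.log (6 / 5)) (ε₀ := 19 / 500) (ε₁ := 19 / 1000) (c := 38993 / 500000) (lam := 20643 / 1000000) (E := 259683 / 250000) (E₂ := 509591 / 500000) (τ := 287 / 250) (Ks := 108983 / 50000) (Sq := 266501 / 250000) (t := Real.log (6 / 5)) (T₁ := 6 / 5) (T₂ := 36 / 25)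
    (by norm_num) (by norm_num) (by norm_num) (Real.log_nonneg (by norm_num)) le_rfl (by refine (Real.exp_bound' (x := 19 / 500) (by norm_num) (by norm_num) (n := 5) (by norm_num)).trans ?_; simp only [Finset.sum_range_succ, Finset.sum_range_zero, Nat.factorial]; norm_num)
    (by refine (Real.exp_bound' (x := 19 / 500 / 2) (by norm_num) (by norm_num) (n := 5) (by norm_num)).trans ?_; simp only [Finset.sum_range_succ, Finset.sum_range_zero, Nat.factorial]; norm_num)
    (by norm_num) (by norm_num) (by norm_num) (by norm_num) (by norm_num) (by rw [Real.exp_log (by norm_num)]) (by rw [show (2 : ℝ) * Real.log (6 / 5) = Real.log ((6 / 5) ^ 2) by rw [Real.log_pow]; norm_num, Real.exp_log (by norm_num)]; norm_num)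
    (by norm_num) (by norm_num) (by norm_num) (by unfold doorPoly; norm_num) (by unfold gaugeR Delta; norm_num)
  have e1 : (31 / 100 : ℝ) / 3 = 31 / 300 := by norm_num
  rw [e1] at h
  exact h

end Summit.Ventures.YMGap.RobustBall

end
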